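import Summits.QuantumFields.YangMills.Theorems.BalabanUVNodesN18CombStepNearIdentity
import Summits.QuantumFields.YangMills.Theorems.BalabanUVNodesN18CombStepSecondOrderLipschitz
import HarnessLib

/-!
# BalabanUVNodes ∕ node N18 = NE5 — closure-ledger item (iii), comb step M4c, file (6b):
# THE LINEARISATION REMAINDER IS LIPSCHITZ WITH CONSTANT ∝ RADIUS — PRELIMINARIES (abstract logarithmic part, scalar envelope)

(Track A, DAG node N18 = `T4OutputRate.NE5`; cluster K4 «SpineRates», key item K3⁸ `SpineGivenEndpointR13SepCoPHV` (stmt-QuantumFields-27366);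
seat pub-ymgap-dag-n18-w3 g5, INTENT-6 = design step M4c of `COMB-STEP-DESIGN.md` ∕ `COMB-CHAIN-INDEX.md`.)

HONEST FRAMING.  Count-neutral kernel bookkeeping (`--supports stmt-QuantumFields-27366 --as helper`).  The C¹ cancelled sum of the comb step
((4d) `norm_nabla_transported_comb_le`) bounds the coarse covariant derivative of the linearisation remainder `Rem = W − main` CRUDELY by `2‖Rem‖∕ξ`,
which is the one C¹ side term of FILE 7 without `η_j`-decay (`2R∕ξ²`).  The cure (M4c) is a coarse-Lipschitz estimate: `Rem` at the next coarse bond is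
the same functional of the translated fields ((6a) `potRem_translate`), and THIS file proves the functional is Lipschitz in the fields with a constant
carrying the radius `(s + t)` — every piece of the C⁰ chain (I1's `norm_mlog_avgUnits_mul_inv_sub_linAvg_le`) is second order: `log(1+Z) − Z`
((6b-alg) `norm_mlog_sub_sub_mlog_sub_le`), `Z − (Ū(S) − Ū(U₀)) = (Ū(S) − Ū(U₀))(Ū(U₀)⁻¹ − 1)`, the two Prop. 3 remainders (g3's units-carrier Lipschitz
twin `norm_avgRemU_sub_avgRemU_le`, King's Cauchy road), `Q₁((E − 1)(U₀ − 1))`, and the chart `Q₁(e^{iηA} − 1 − iηA)` ((6b-alg)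
`norm_exp_sub_sub_exp_sub_le`).  Constants are NOT optimised (`390000`, `800000`: envelope constants absorbed by the radii bootstrap).  Nothing of
Bałaban's analysis is asserted beyond the cited tree theorems; NE5 NOT printed ∕ NOT proved; N18 NOT discharged; finite tori — nothing about the
continuum ∕ OS ∕ mass gap; YM mass gap (Clay) NOT proved — R4 closes the conditional finite-𝕋⁴ rung `BalabanLadder.UV` only.

WHAT (this file = the two field-free pieces of (6b) `…CombStepRemainderLipschitz`, split off for the 400-line rule).
* §1 `norm_logPart_sub_logPart_le` — abstract Banach-algebra letter: the Lipschitz bound of `(A, B) ↦ log(A·B⁻¹) − (A − B)` near `(1, 1)`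
  ((6b-alg) `norm_mlog_sub_sub_mlog_sub_le` for `log(1+Z) − Z`, `Z − (A − B) = (A − B)(B⁻¹ − 1)`, `B′⁻¹ − B⁻¹ = B′⁻¹(B − B′)B⁻¹`).
* §2a `mlogRem_envelope` — the scalar envelope (pure real arithmetic) summing the four Lipschitz pieces to `390000·ℓ²·(s+t)·W`.

0 `def`, 0 `sorry`.  References: T. Bałaban, CMP **98** (1985) 17–51 [Balaban1985Averaging] (Prop. 3 (122)–(126) p.36, (21)/(26) pp.21–22, (62)–(63) p.28);
CMP **109** (1987) 249–301 [Balaban1987RG1] ((0.4) p.253, (1.12)–(1.13) p.262); C. King, CMP **102** (1986) 649–677 [King1986] ((3.43)–(3.47) p.661).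
-/

noncomputable section

open scoped BigOperators Matrix.Norms.L2Operator
open NormedSpace

namespace YMDAG.N18.TransportOfRecord

open Complex (I)
open Literature.MathematicalPhysics.QuantumFieldTheory.Balaban1983to89
open Literature.MathematicalPhysics.QuantumFieldTheory.Balaban1983to89.T4Continuum
open Literature.MathematicalPhysics.QuantumFieldTheory.Balaban1983to89.BlockAveraging
open Literature.MathematicalPhysics.QuantumFieldTheory.Balaban1983to89.BlockAveragingEMLLinearised (linAvg)
open Literature.MathematicalPhysics.QuantumFieldTheory.Balaban1983to89.B12RegularSpaces111 (expI)
open Literature.MathematicalPhysics.QuantumFieldTheory.Balaban1983to89.B12Lemma4Concrete (val_expI)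
open Literature.MathematicalPhysics.QuantumFieldTheory.Balaban1983to89.B12Membership314 (norm_I_mul_smul)
open Literature.MathematicalPhysics.QuantumFieldTheory.Balaban1983to89.MatrixLog (mlog)
open Literature.MathematicalPhysics.QuantumFieldTheory.Balaban1983to89.Node00.W1 (avgUnits)

/-! ## §1 The abstract letter: `(A, B) ↦ log(A·B⁻¹) − (A − B)` is Lipschitz near `(1, 1)` with a small constant -/

section Abstract

variable {𝔸 : Type*} [NormedRing 𝔸] [NormedAlgebra ℂ 𝔸] [CompleteSpace 𝔸]

/-- **THE LOGARITHMIC PART**: for `A, A′, B, B′` with `B·B⁻¹ = 1`, `B′·B′⁻¹ = B′⁻¹·B′ = 1`, `‖A − B‖, ‖A′ − B′‖ ≤ ρ`, `‖B⁻¹‖, ‖B′⁻¹‖ ≤ 2`, `‖B′⁻¹ − 1‖ ≤ τ`,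
`‖A′ − A‖ ≤ K_A`, `‖B′ − B‖ ≤ K_B`, `22ρ ≤ 1`:  with `Z = (A − B)B⁻¹` (so `A·B⁻¹ = 1 + Z`, `‖Z‖ ≤ 2ρ`),
`‖[log(A′B′⁻¹) − (A′ − B′)] − [log(AB⁻¹) − (A − B)]‖ ≤ (11∕10)·2ρ·(2(K_A + K_B) + 4ρK_B) + ((K_A + K_B)·τ + 4ρ·K_B)`
(`log(1+Z) − Z` is `r∕(1−r)`-Lipschitz, `Z − (A − B) = (A − B)(B⁻¹ − 1)`, `B′⁻¹ − B⁻¹ = B′⁻¹(B − B′)B⁻¹`).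
[cite: Balaban1985Averaging, (21) p.21, (26) p.22, Prop. 3 (126) p.36] -/
theorem norm_logPart_sub_logPart_le {A B Binv A' B' Binv' : 𝔸} {ρ τ KA KB : ℝ} (hBB : B * Binv = 1) (hBB' : B' * Binv' = 1)
    (hBiB' : Binv' * B' = 1) (hρ0 : 0 ≤ ρ) (hKA : 0 ≤ KA) (hKB : 0 ≤ KB)
    (hAB : ‖A - B‖ ≤ ρ) (hAB' : ‖A' - B'‖ ≤ ρ) (hBi1 : ‖Binv‖ ≤ 2) (hBi1' : ‖Binv'‖ ≤ 2) (hBi2' : ‖Binv' - 1‖ ≤ τ)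
    (hdA : ‖A' - A‖ ≤ KA) (hdB : ‖B' - B‖ ≤ KB) (hρ : 22 * ρ ≤ 1) :
    ‖(mlog (A' * Binv') - (A' - B')) - (mlog (A * Binv) - (A - B))‖ ≤
      11 / 10 * (2 * ρ) * (2 * (KA + KB) + 4 * ρ * KB) + ((KA + KB) * τ + 4 * ρ * KB) := by
  set Z : 𝔸 := (A - B) * Binv with hZ
  set Z' : 𝔸 := (A' - B') * Binv' with hZ'
  have hABZ : A * Binv = 1 + Z := by rw [hZ, sub_mul, hBB]; abel
  have hABZ' : A' * Binv' = 1 + Z' := by rw [hZ', sub_mul, hBB']; abel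
  -- sizes
  have hZn : ‖Z‖ ≤ 2 * ρ := by
    rw [hZ]; refine (norm_mul_le _ _).trans ?_
    calc ‖A - B‖ * ‖Binv‖ ≤ ρ * 2 := mul_le_mul hAB hBi1 (norm_nonneg _) hρ0
      _ = 2 * ρ := by ring
  have hZn' : ‖Z'‖ ≤ 2 * ρ := by
    rw [hZ']; refine (norm_mul_le _ _).trans ?_
    calc ‖A' - B'‖ * ‖Binv'‖ ≤ ρ * 2 := mul_le_mul hAB' hBi1' (norm_nonneg _) hρ0
      _ = 2 * ρ := by ring
  -- differences
  have hdAB : ‖(A' - B') - (A - B)‖ ≤ KA + KB := by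
    have : (A' - B') - (A - B) = (A' - A) - (B' - B) := by abel
    rw [this]; exact (norm_sub_le _ _).trans (add_le_add hdA hdB)
  have hdBinv : ‖Binv' - Binv‖ ≤ 4 * KB := by
    have hid : Binv' - Binv = Binv' * (B - B') * Binv := by
      rw [mul_sub, sub_mul, mul_assoc Binv' B Binv, hBB, hBiB', mul_one, one_mul]
    rw [hid]
    calc ‖Binv' * (B - B') * Binv‖ ≤ ‖Binv'‖ * ‖B - B'‖ * ‖Binv‖ :=
          (norm_mul_le _ _).trans (mul_le_mul_of_nonneg_right (norm_mul_le _ _) (norm_nonneg _))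
      _ ≤ 2 * KB * 2 := by
          rw [norm_sub_rev] at hdB
          exact mul_le_mul (mul_le_mul hBi1' hdB (norm_nonneg _) (by norm_num)) hBi1 (norm_nonneg _) (by positivity)
      _ = 4 * KB := by ring
  have hdZ : ‖Z' - Z‖ ≤ 2 * (KA + KB) + 4 * ρ * KB := by
    have hid : Z' - Z = ((A' - B') - (A - B)) * Binv' + (A - B) * (Binv' - Binv) := by
      rw [hZ, hZ']; noncomm_ring
    rw [hid]
    calc _ ≤ ‖(A' - B') - (A - B)‖ * ‖Binv'‖ + ‖A - B‖ * ‖Binv' - Binv‖ :=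
          (norm_add_le _ _).trans (add_le_add (norm_mul_le _ _) (norm_mul_le _ _))
      _ ≤ (KA + KB) * 2 + ρ * (4 * KB) :=
          add_le_add (mul_le_mul hdAB hBi1' (norm_nonneg _) (by positivity)) (mul_le_mul hAB hdBinv (norm_nonneg _) hρ0)
      _ = 2 * (KA + KB) + 4 * ρ * KB := by ring
  -- T1: the second-order logarithm
  have hr1 : 2 * ρ < 1 := by linarith
  have hT1 := norm_mlog_sub_sub_mlog_sub_le (Z := Z') (Z' := Z) hr1 hZn' hZn
  have hT1' : ‖(mlog (1 + Z') - Z') - (mlog (1 + Z) - Z)‖ ≤ 11 / 10 * (2 * ρ) * (2 * (KA + KB) + 4 * ρ * KB) := by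
    have hpos : 0 < 1 - 2 * ρ := by linarith
    have h := (le_div_iff₀ hpos).1 hT1
    have hnn : 0 ≤ ‖(mlog (1 + Z') - Z') - (mlog (1 + Z) - Z)‖ := norm_nonneg _
    have hDZ0 : 0 ≤ 2 * (KA + KB) + 4 * ρ * KB := by positivity
    nlinarith [mul_nonneg (sub_nonneg.2 hρ) hnn, mul_le_mul_of_nonneg_left hdZ (by positivity : (0 : ℝ) ≤ 2 * ρ), norm_nonneg (Z' - Z)]
  -- T2: `Z − (A − B) = (A − B)(B⁻¹ − 1)`
  have hT2 : ‖(Z' - (A' - B')) - (Z - (A - B))‖ ≤ (KA + KB) * τ + 4 * ρ * KB := by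
    have hid : (Z' - (A' - B')) - (Z - (A - B)) = ((A' - B') - (A - B)) * (Binv' - 1) + (A - B) * (Binv' - Binv) := by
      rw [hZ, hZ']; noncomm_ring
    rw [hid]
    calc _ ≤ ‖(A' - B') - (A - B)‖ * ‖Binv' - 1‖ + ‖A - B‖ * ‖Binv' - Binv‖ :=
          (norm_add_le _ _).trans (add_le_add (norm_mul_le _ _) (norm_mul_le _ _))
      _ ≤ (KA + KB) * τ + ρ * (4 * KB) :=
          add_le_add (mul_le_mul hdAB hBi2' (norm_nonneg _) (by positivity)) (mul_le_mul hAB hdBinv (norm_nonneg _) hρ0)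
      _ = (KA + KB) * τ + 4 * ρ * KB := by ring
  -- assemble
  rw [hABZ, hABZ']
  have hsplit : (mlog (1 + Z') - (A' - B')) - (mlog (1 + Z) - (A - B)) =
      ((mlog (1 + Z') - Z') - (mlog (1 + Z) - Z)) + ((Z' - (A' - B')) - (Z - (A - B))) := by abel
  rw [hsplit]
  exact (norm_add_le _ _).trans (add_le_add hT1' hT2)

end Abstract

/-! ## §2a The scalar envelope of §2 (pure real arithmetic, kept out of the matrix context) -/

section Scalar

/-- The numeric envelope of `norm_mlogRem_sub_mlogRem_le`: with `ρ = 17ℓσ`, `τ = 34ℓt`, `ℓσ ≤ 1∕384`, `K_A ≤ 446ℓW`, `K_B ≤ 223ℓW`, `t, e ≤ σ`,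
`ε_E, ε_U ≤ W`: the four Lipschitz pieces sum to at most `390000·ℓ²σW`. [folklore] -/
theorem mlogRem_envelope {ℓ σ t e εE εU W KA KB : ℝ} (hℓ1 : 1 ≤ ℓ) (hσ0 : 0 ≤ σ) (ht0 : 0 ≤ t) (htσ : t ≤ σ) (heσ : e ≤ σ)
    (hℓσ : ℓ * σ ≤ 1 / 384) (hεE : 0 ≤ εE) (hεU : 0 ≤ εU) (hεEW : εE ≤ W) (hεUW : εU ≤ W) (hKA0 : 0 ≤ KA) (hKB0 : 0 ≤ KB)
    (hKA : KA ≤ 446 * ℓ * W) (hKB : KB ≤ 223 * ℓ * W) :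
    11 / 10 * (2 * (17 * ℓ * σ)) * (2 * (KA + KB) + 4 * (17 * ℓ * σ) * KB) + ((KA + KB) * (2 * (17 * ℓ * t)) + 4 * (17 * ℓ * σ) * KB) +
        (84480 * ℓ ^ 2 * σ * (2 * W) + 84480 * ℓ ^ 2 * σ * εU) + 3 * ℓ * (εE * t + e * εU) ≤ 390000 * ℓ ^ 2 * σ * W := by
  have hℓ0 : 0 ≤ ℓ := by linarith
  have hW0 : 0 ≤ W := hεE.trans hεEW
  have hℓW : 0 ≤ ℓ * W := mul_nonneg hℓ0 hW0
  have hℓσ0 : 0 ≤ ℓ * σ := mul_nonneg hℓ0 hσ0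
  have hℓσW : 0 ≤ ℓ ^ 2 * σ * W := by positivity
  have hin : 2 * (KA + KB) + 4 * (17 * ℓ * σ) * KB ≤ 1378 * (ℓ * W) := by nlinarith
  have h1 : 11 / 10 * (2 * (17 * ℓ * σ)) * (2 * (KA + KB) + 4 * (17 * ℓ * σ) * KB) ≤ 52364 * (ℓ ^ 2 * σ * W) := by
    have := mul_le_mul_of_nonneg_left hin (by positivity : (0 : ℝ) ≤ 11 / 10 * (2 * (17 * ℓ * σ)))
    nlinarith
  have h2 : (KA + KB) * (2 * (17 * ℓ * t)) + 4 * (17 * ℓ * σ) * KB ≤ 37910 * (ℓ ^ 2 * σ * W) := by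
    have ha : (KA + KB) * (2 * (17 * ℓ * t)) ≤ (669 * ℓ * W) * (34 * ℓ * σ) :=
      mul_le_mul (by linarith) (by nlinarith) (by positivity) (by positivity)
    have hb : 4 * (17 * ℓ * σ) * KB ≤ 4 * (17 * ℓ * σ) * (223 * ℓ * W) := mul_le_mul_of_nonneg_left hKB (by positivity)
    nlinarith
  have h3 : 84480 * ℓ ^ 2 * σ * (2 * W) + 84480 * ℓ ^ 2 * σ * εU ≤ 253440 * (ℓ ^ 2 * σ * W) := by
    have := mul_le_mul_of_nonneg_left hεUW (by positivity : (0 : ℝ) ≤ 84480 * ℓ ^ 2 * σ)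
    nlinarith
  have h4 : 3 * ℓ * (εE * t + e * εU) ≤ 6 * (ℓ ^ 2 * σ * W) := by
    have ha : εE * t + e * εU ≤ σ * W + σ * W := add_le_add (by nlinarith) (by nlinarith)
    have hb : 3 * ℓ * (εE * t + e * εU) ≤ 3 * ℓ * (σ * W + σ * W) := mul_le_mul_of_nonneg_left ha (by positivity)
    have hc : ℓ * (σ * W) ≤ ℓ ^ 2 * (σ * W) := by nlinarith [mul_nonneg hσ0 hW0]
    nlinarith
  nlinarith

end Scalar

end YMDAG.N18.TransportOfRecord

end
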